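import Mathlib
import Literature.LinearAlgebra.Matrix.AdjugateKernelLine
import Literature.Probability.LatticeModels.TemperleyLiebBaxterization
import Literature.Probability.Percolation.DiagonalColumnPatterns
import Literature.Probability.Percolation.DiagonalStripTransferExplicit
import Literature.Probability.Percolation.DiagonalStripDoeblin
import Literature.Probability.Percolation.DiagonalStripStationary
import Literature.Probability.Percolation.DiagonalStripLumping
import Literature.Probability.Percolation.DiagonalStripTransferInhomogeneous
import Literature.Probability.Percolation.DiagonalStripTransferInterlacingTwoRow
import Literature.Probability.Percolation.DiagonalStripGenericRapidities
import Literature.Probability.Percolation.DiagonalStripGenericSwap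
import HarnessLib

/-!
# Generic simplicity of the ground state of Ikhlef–Ponsaing's transfer matrix

Topic `Literature/Probability/Percolation`. Ikhlef–Ponsaing (J. Stat. Phys. 149 (2012),
arXiv:1202.5476) §3.4 use that "the ground state [of `t(w; z⃗)`] is unique" to derive the qKZ
equations from the interlacing relations. This file proves that statement in the generic setting
of `DiagonalStripGenericRapidities.lean` (rapidities = indeterminates of `Frac ℂ[w, z_1, z_2, …]`,
`q` a primitive cube root of unity): **`ipTransferMatrixW_fixed_proportional`** — any two vectors
`ψ` with `ψ(Q') = Σ_Q t(w; z⃗)(Q → Q') ψ(Q)` are proportional — and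
**`exists_ipTransferMatrixW_fixed_ne_zero`** — a nonzero one exists (with polynomial components:
`exists_ipTransferMatrixW_fixed_polynomial`).

Proof (rank semicontinuity through adjugates): at the percolation point `w = w₀` (`w₀² = -q`),
`z_k = 1` all tile weights equal `1/2` (`eval_ipNumPoly`, `eval_ipDenPoly`) and `t` becomes the
lumped two-layer kernel of the dictionary, whose fixed space is the line of `π̄`
(`eq_smul_ipStationaryL_of_ipTwoLayerW_half`, from the Doeblin contraction of
`DiagonalStripDoeblin.lean` / `DiagonalStripLumping.lean`; transported to `ℂ` by real and imaginary
parts); hence `adj(t(½) - 1) ≠ 0` (`Literature.LinearAlgebra.Matrix.adjugate_ne_zero_of_vecMul_line`);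
clearing denominators (`ipTransferWR`, `ipNumPoly`, `ipDenPoly`, `ipNMat = Δ·(t - 1)` as a polynomial
matrix, `mapMatrix_toRF_ipNMat`, `mapMatrix_eval_ipNMat`) and using that adjugates commute with
ring homomorphisms, `adj(t(w; z⃗) - 1) ≠ 0` over the rapidity field
(`adjugate_ipTMat_complex_sub_one_ne_zero`), so its left kernel is a line.

## References

* Y. Ikhlef, A. K. Ponsaing, J. Stat. Phys. 149 (2012) 10–36, arXiv:1202.5476, §3.4.
  [IkhlefPonsaing2012]
-/

namespace Literature.Probability.Percolation

open Literature.Probability.LatticeModels Literature.LinearAlgebra.Matrix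

variable {m : ℕ}

/-! ### The fixed space of the percolation-point transfer matrix is the line of `π̄` -/

section FixedSpace

/-- A lumped law vanishes off lump-fixed patterns. [folklore] -/
theorem lumpLaw_eq_zero_of_lump_ne (μ : ColPattern m → ℝ) {Q : ColPattern m} (h : lump Q ≠ Q) :
    lumpLaw μ Q = 0 := by
  unfold lumpLaw
  refine Finset.sum_eq_zero fun P hP => ?_
  exfalso
  have hPQ := (Finset.mem_filter.1 hP).2
  exact h (by rw [← hPQ, lump_lump])

/-- **A fixed signed vector of total mass `0` vanishes** (Doeblin contraction upstairs).
[cite: IkhlefPonsaing2012, §3.4] -/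
theorem eq_zero_of_fixed_of_sum_eq_zero (ν : ColPattern m → ℝ) (hν0 : ∑ Q, ν Q = 0)
    (hsupp : ∀ Q, lump Q ≠ Q → ν Q = 0)
    (hfix : pushLawL m 1 (pushLawL m 0 ν) = ν) : ν = 0 := by
  set ε := (1 / 2 : ℝ) ^ ((m + 1) * (m + 1)) with hε
  have hε1 : ε ≤ 1 := pow_le_one₀ (by norm_num) (by norm_num)
  have hε0 : 0 < ε := by positivity
  set f : (ColPattern m → ℝ) → (ColPattern m → ℝ) := fun x => pushLaw m 1 (pushLaw m 0 x) with hf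
  have hsum0 : ∀ n, ∑ P, (f^[n] ν) P = 0 := by
    intro n
    induction n with
    | zero => simpa using hν0
    | succ n ih => rw [Function.iterate_succ_apply', hf, sum_pushLaw, sum_pushLaw, ih]
  have hcontr : ∀ n, l1 (f^[n] ν) ≤ ((1 - ε) * (1 - ε)) ^ n * l1 ν := by
    intro n
    induction n with
    | zero => simp
    | succ n ih =>
      rw [Function.iterate_succ_apply']
      have h0 : ∑ P, pushLaw m 0 (f^[n] ν) P = 0 := by rw [sum_pushLaw, hsum0]
      calc l1 (pushLaw m 1 (pushLaw m 0 (f^[n] ν)))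
          ≤ (1 - ε) * l1 (pushLaw m 0 (f^[n] ν)) := l1_pushLaw_le 1 _ h0
        _ ≤ (1 - ε) * ((1 - ε) * l1 (f^[n] ν)) :=
            mul_le_mul_of_nonneg_left (l1_pushLaw_le 0 _ (hsum0 n)) (sub_nonneg.2 hε1)
        _ ≤ (1 - ε) * ((1 - ε) * (((1 - ε) * (1 - ε)) ^ n * l1 ν)) :=
            mul_le_mul_of_nonneg_left (mul_le_mul_of_nonneg_left ih (sub_nonneg.2 hε1)) (sub_nonneg.2 hε1)
        _ = ((1 - ε) * (1 - ε)) ^ (n + 1) * l1 ν := by ring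
  -- downstairs the iterates are constant, equal to `ν`
  have hlump : ∀ n, lumpLaw (f^[n] ν) = ν := by
    intro n
    induction n with
    | zero => rw [Function.iterate_zero, id_eq, lumpLaw_eq_self hsupp]
    | succ n ih =>
      rw [Function.iterate_succ_apply', hf]
      show lumpLaw (pushLaw m 1 (pushLaw m 0 (f^[n] ν))) = _
      rw [lumpLaw_pushLaw, lumpLaw_pushLaw, ih, hfix]
  have hbound : ∀ n, l1 ν ≤ ((1 - ε) * (1 - ε)) ^ n * l1 ν := fun n =>
    (hlump n ▸ l1_lumpLaw_le (f^[n] ν)).trans (hcontr n)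
  have hl1nn : 0 ≤ l1 ν := Finset.sum_nonneg fun P _ => abs_nonneg _
  have hq1 : (1 - ε) * (1 - ε) < 1 := by nlinarith
  have hq0 : 0 ≤ (1 - ε) * (1 - ε) := mul_nonneg (sub_nonneg.2 hε1) (sub_nonneg.2 hε1)
  have hlim : Filter.Tendsto (fun n => ((1 - ε) * (1 - ε)) ^ n * l1 ν) Filter.atTop (nhds 0) := by
    simpa using (tendsto_pow_atTop_nhds_zero_of_lt_one hq0 hq1).mul_const (l1 ν)
  have hl1 : l1 ν = 0 := le_antisymm (ge_of_tendsto' hlim hbound) hl1nn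
  funext Q
  have := (Finset.sum_eq_zero_iff_of_nonneg fun P _ => abs_nonneg (ν P)).1 hl1 Q (Finset.mem_univ Q)
  rwa [abs_eq_zero] at this

/-- **The fixed space of `T̄₀ T̄₁` is the line spanned by `π̄`.** [cite: IkhlefPonsaing2012, §3.4] -/
theorem eq_smul_ipStationaryL_of_fixed (ν : ColPattern m → ℝ) (hsupp : ∀ Q, lump Q ≠ Q → ν Q = 0)
    (hfix : pushLawL m 1 (pushLawL m 0 ν) = ν) : ν = (∑ Q, ν Q) • ipStationaryL m := by
  by_cases hs : ∑ Q, ν Q = 0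
  · rw [hs, zero_smul]
    exact eq_zero_of_fixed_of_sum_eq_zero ν hs hsupp hfix
  · set s := ∑ Q, ν Q with hsdef
    have h1 : ∑ Q, (s⁻¹ • ν) Q = 1 := by
      simp only [Pi.smul_apply, smul_eq_mul, ← Finset.mul_sum]
      exact inv_mul_cancel₀ hs
    have hsupp' : ∀ Q, lump Q ≠ Q → (s⁻¹ • ν) Q = 0 := fun Q hQ => by
      simp only [Pi.smul_apply, hsupp Q hQ, smul_zero]
    have hlin : ∀ (c : ℤ) (a : ℝ) (μ : ColPattern m → ℝ), pushLawL m c (a • μ) = a • pushLawL m c μ := by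
      intro c a μ
      funext Q'
      simp only [pushLawL, Pi.smul_apply, smul_eq_mul, Finset.mul_sum, mul_assoc]
    have hfix' : pushLawL m 1 (pushLawL m 0 (s⁻¹ • ν)) = s⁻¹ • ν := by rw [hlin, hlin, hfix]
    have h := eq_ipStationaryL_of_fixed (s⁻¹ • ν) h1 hsupp' hfix'
    calc ν = s • (s⁻¹ • ν) := by rw [smul_smul, mul_inv_cancel₀ hs, one_smul]
      _ = s • ipStationaryL m := by rw [h]

/-- **The percolation-point transfer matrix as a push**: `ν t(½) = ν T̄₀ T̄₁` for every `ν`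
(no support hypothesis: `T̄₀` already lands on lump-fixed patterns). [cite: IkhlefPonsaing2012, §3.4] -/
theorem sum_mul_ipTwoLayerW_half (ν : ColPattern m → ℝ) (Q' : ColPattern m) :
    ∑ Q, ν Q * ipTwoLayerW m (fun _ => (1 / 2 : ℝ)) (fun _ => (1 / 2 : ℝ)) Q Q' =
      pushLawL m 1 (pushLawL m 0 ν) Q' := by
  classical
  simp only [ipTwoLayerW_const_half, pushLawL]
  -- `∑_Q ν Q ∑_{Q₁ fixed} T̄₀ T̄₁ = ∑_{Q₁} (∑_Q ν Q T̄₀(Q,Q₁)) T̄₁(Q₁,Q')`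
  have h : ∀ Q, ∑ Q₁ ∈ Finset.univ.filter (fun Q₁ : ColPattern m => lump Q₁ = Q₁),
      ipTransferL m 0 Q Q₁ * ipTransferL m 1 Q₁ Q' = ∑ Q₁, ipTransferL m 0 Q Q₁ * ipTransferL m 1 Q₁ Q' := by
    intro Q
    refine Finset.sum_subset (Finset.subset_univ _) fun Q₁ _ hQ₁ => ?_
    have hne : lump Q₁ ≠ Q₁ := fun h => hQ₁ (Finset.mem_filter.2 ⟨Finset.mem_univ _, h⟩)
    rw [ipTransferL, lumpLaw_eq_zero_of_lump_ne _ hne, zero_mul]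
  simp only [h, Finset.mul_sum, Finset.sum_mul]
  rw [Finset.sum_comm]
  refine Finset.sum_congr rfl fun Q₁ _ => Finset.sum_congr rfl fun Q _ => ?_
  ring

/-- **Simplicity of the eigenvalue `1` at the percolation point**: every vector fixed by
`t(½)` (acting on row vectors, the stationary-distribution side) is a multiple of `π̄`.
[cite: IkhlefPonsaing2012, §3.4] -/
theorem eq_smul_ipStationaryL_of_ipTwoLayerW_half (ν : ColPattern m → ℝ)
    (hfix : ∀ Q', ∑ Q, ν Q * ipTwoLayerW m (fun _ => (1 / 2 : ℝ)) (fun _ => (1 / 2 : ℝ)) Q Q' = ν Q') :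
    ν = (∑ Q, ν Q) • ipStationaryL m := by
  have hfix' : pushLawL m 1 (pushLawL m 0 ν) = ν := funext fun Q' => by rw [← sum_mul_ipTwoLayerW_half, hfix]
  refine eq_smul_ipStationaryL_of_fixed ν (fun Q hQ => ?_) hfix'
  -- support: `ν Q = (ν T̄₀ T̄₁)(Q) = 0` off lump-fixed patterns
  rw [← congrFun hfix' Q, pushLawL]
  refine Finset.sum_eq_zero fun Q₁ _ => ?_
  rw [ipTransferL, lumpLaw_eq_zero_of_lump_ne _ hQ, mul_zero]

end FixedSpace

/-! ### Ring-level two-weight layer kernels (to clear denominators) -/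

section RingKernel

variable {R S : Type*} [CommRing R] [CommRing S]

/-- The layer kernel with separate "open" and "closed" weights `a e`, `b e` over a commutative
ring: `Σ_U [F_c(P, 1_U) = P'] ∏_{e ∈ U} a e ∏_{e ∈ layer∖U} b e`. [folklore] -/
noncomputable def ipTransferWR (m : ℕ) (c : ℤ) (a b : Sym2 (Site 2) → R) (P P' : ColPattern m) : R :=
  ∑ U ∈ (latticeLayer m c).powerset,
    if colUpdate m c P (edgeFn m c U) = P' then (∏ e ∈ U, a e) * ∏ e ∈ latticeLayer m c \ U, b e else 0

/-- The two-layer lumped kernel with separate open/closed weights in both rows. [folklore] -/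
noncomputable def ipTwoLayerWR (m : ℕ) (a₀ b₀ a₁ b₁ : Sym2 (Site 2) → R) (Q Q' : ColPattern m) : R :=
  ∑ P₁ : ColPattern m, ∑ P₂ ∈ Finset.univ.filter (fun P₂ : ColPattern m => lump P₂ = Q'),
    ipTransferWR m 0 a₀ b₀ Q P₁ * ipTransferWR m 1 a₁ b₁ P₁ P₂

/-- Over a field the weighted kernel is the two-weight kernel with `b = 1 - a`. [folklore] -/
theorem ipTransferW_eq_ipTransferWR {K : Type*} [Field K] (c : ℤ) (p : Sym2 (Site 2) → K)
    (P P' : ColPattern m) : ipTransferW m c p P P' = ipTransferWR m c p (fun e => 1 - p e) P P' := rfl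

/-- The same for the two-layer kernel. [folklore] -/
theorem ipTwoLayerW_eq_ipTwoLayerWR {K : Type*} [Field K] (p₀ p₁ : Sym2 (Site 2) → K) (Q Q' : ColPattern m) :
    ipTwoLayerW m p₀ p₁ Q Q' = ipTwoLayerWR m p₀ (fun e => 1 - p₀ e) p₁ (fun e => 1 - p₁ e) Q Q' := rfl

/-- Ring homomorphisms act entrywise. [folklore] -/
theorem map_ipTransferWR (φ : R →+* S) (c : ℤ) (a b : Sym2 (Site 2) → R) (P P' : ColPattern m) :
    φ (ipTransferWR m c a b P P') = ipTransferWR m c (φ ∘ a) (φ ∘ b) P P' := by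
  unfold ipTransferWR
  rw [map_sum]
  refine Finset.sum_congr rfl fun U _ => ?_
  split_ifs
  · simp only [map_mul, map_prod, Function.comp]
  · exact map_zero φ

/-- Ring homomorphisms act entrywise (two layers). [folklore] -/
theorem map_ipTwoLayerWR (φ : R →+* S) (a₀ b₀ a₁ b₁ : Sym2 (Site 2) → R) (Q Q' : ColPattern m) :
    φ (ipTwoLayerWR m a₀ b₀ a₁ b₁ Q Q') = ipTwoLayerWR m (φ ∘ a₀) (φ ∘ b₀) (φ ∘ a₁) (φ ∘ b₁) Q Q' := by
  unfold ipTwoLayerWR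
  simp only [map_sum, map_mul, map_ipTransferWR]

/-- The kernel only sees the weights on the layer. [folklore] -/
theorem ipTransferWR_congr (c : ℤ) {a b a' b' : Sym2 (Site 2) → R}
    (h : ∀ e ∈ latticeLayer m c, a e = a' e ∧ b e = b' e) (P P' : ColPattern m) :
    ipTransferWR m c a b P P' = ipTransferWR m c a' b' P P' := by
  unfold ipTransferWR
  refine Finset.sum_congr rfl fun U hU => ?_
  have hUs : U ⊆ latticeLayer m c := Finset.mem_powerset.1 hU
  split_ifs
  · rw [Finset.prod_congr rfl fun e he => (h e (hUs he)).1,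
      Finset.prod_congr rfl fun e he => (h e (Finset.sdiff_subset he)).2]
  · rfl

/-- **Scaling**: a common factor `u e` on both weights of every edge comes out as `∏_{layer} u e`.
[folklore] -/
theorem ipTransferWR_mul (c : ℤ) (u a b : Sym2 (Site 2) → R) (P P' : ColPattern m) :
    ipTransferWR m c (fun e => u e * a e) (fun e => u e * b e) P P' =
      (∏ e ∈ latticeLayer m c, u e) * ipTransferWR m c a b P P' := by
  unfold ipTransferWR
  rw [Finset.mul_sum]
  refine Finset.sum_congr rfl fun U hU => ?_
  have hUs : U ⊆ latticeLayer m c := Finset.mem_powerset.1 hU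
  split_ifs
  · rw [Finset.prod_mul_distrib, Finset.prod_mul_distrib, ← Finset.prod_sdiff hUs (f := u)]
    ring
  · rw [mul_zero]

/-- Scaling for the two-layer kernel. [folklore] -/
theorem ipTwoLayerWR_mul (u₀ a₀ b₀ u₁ a₁ b₁ : Sym2 (Site 2) → R) (Q Q' : ColPattern m) :
    ipTwoLayerWR m (fun e => u₀ e * a₀ e) (fun e => u₀ e * b₀ e) (fun e => u₁ e * a₁ e) (fun e => u₁ e * b₁ e) Q Q' =
      ((∏ e ∈ latticeLayer m 0, u₀ e) * ∏ e ∈ latticeLayer m 1, u₁ e) * ipTwoLayerWR m a₀ b₀ a₁ b₁ Q Q' := by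
  unfold ipTwoLayerWR
  simp only [ipTransferWR_mul, Finset.mul_sum]
  refine Finset.sum_congr rfl fun P₁ _ => Finset.sum_congr rfl fun P₂ _ => ?_
  ring

/-- Congruence for the two-layer kernel. [folklore] -/
theorem ipTwoLayerWR_congr {a₀ b₀ a₁ b₁ a₀' b₀' a₁' b₁' : Sym2 (Site 2) → R}
    (h0 : ∀ e ∈ latticeLayer m 0, a₀ e = a₀' e ∧ b₀ e = b₀' e)
    (h1 : ∀ e ∈ latticeLayer m 1, a₁ e = a₁' e ∧ b₁ e = b₁' e) (Q Q' : ColPattern m) :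
    ipTwoLayerWR m a₀ b₀ a₁ b₁ Q Q' = ipTwoLayerWR m a₀' b₀' a₁' b₁' Q Q' := by
  unfold ipTwoLayerWR
  simp only [ipTransferWR_congr 0 h0, ipTransferWR_congr 1 h1]

/-- Row sums of the two-weight kernel: `Σ_{P'} = ∏_{layer} (a e + b e)`. [folklore] -/
theorem sum_ipTransferWR (c : ℤ) (a b : Sym2 (Site 2) → R) (P : ColPattern m) :
    ∑ P', ipTransferWR m c a b P P' = ∏ e ∈ latticeLayer m c, (a e + b e) := by
  unfold ipTransferWR
  rw [Finset.sum_comm]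
  simp only [Finset.sum_ite_eq, Finset.mem_univ, if_true]
  rw [Finset.prod_add]

end RingKernel

/-! ### Levels of layer edges -/

section Levels

/-- Edges of the two layers have top level at least `1`. [folklore] -/
theorem one_le_edgeTopLevel_of_mem {c : ℤ} (hc : c = 0 ∨ c = 1) {e : Sym2 (Site 2)} (he : e ∈ latticeLayer m c) :
    1 ≤ (edgeTopLevel e).toNat := by
  rw [latticeLayer_eq_image, Finset.mem_image] at he
  obtain ⟨⟨i, j⟩, -, rfl⟩ := he
  rw [edgeTopLevel_mk_colSite]
  rcases hc with rfl | rfl <;> omega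

end Levels

/-! ### Polynomial numerators and denominators of IP12's tile weights -/

section PolyWeights

open MvPolynomial Literature.Probability.LatticeModels.TemperleyLieb

variable {K₀ : Type*} [Field K₀]

/-- The numerator polynomial of the row-`r` weight of an edge (`A` at odd top level, `B` at even):
row `0` (argument `z_k/w`): `q² X_k² - X_0²`, resp. `q (X_k² - X_0²)`; row `1` (argument
`1/(w z_k)`): `q² - X_0² X_k²`, resp. `q (1 - X_0² X_k²)`. [cite: IkhlefPonsaing2012, Def. 3.1, 3.3] -/
noncomputable def ipNumPoly (q : K₀) (r : Fin 2) (e : Sym2 (Site 2)) : MvPolynomial ℕ K₀ :=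
  if (edgeTopLevel e).toNat % 2 = 1 then
    (if r = 0 then C q ^ 2 * X (edgeTopLevel e).toNat ^ 2 - X 0 ^ 2
      else C q ^ 2 - X 0 ^ 2 * X (edgeTopLevel e).toNat ^ 2)
  else
    (if r = 0 then C q * (X (edgeTopLevel e).toNat ^ 2 - X 0 ^ 2)
      else C q * (1 - X 0 ^ 2 * X (edgeTopLevel e).toNat ^ 2))

/-- The common denominator polynomial of the row-`r` weights of an edge: `q² X_0² - X_k²` in row `0`,
`q² X_0² X_k² - 1` in row `1`. [cite: IkhlefPonsaing2012, Def. 3.1, 3.3] -/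
noncomputable def ipDenPoly (q : K₀) (r : Fin 2) (e : Sym2 (Site 2)) : MvPolynomial ℕ K₀ :=
  if r = 0 then C q ^ 2 * X 0 ^ 2 - X (edgeTopLevel e).toNat ^ 2
  else C q ^ 2 * X 0 ^ 2 * X (edgeTopLevel e).toNat ^ 2 - 1

/-- The denominators are nonzero rational functions (top level `k ≠ 0`). [folklore] -/
theorem toRF_ipDenPoly_ne_zero {q : K₀} (hq : q ≠ 0) (r : Fin 2) {e : Sym2 (Site 2)}
    (hk : (edgeTopLevel e).toNat ≠ 0) : toRF K₀ (ipDenPoly q r e) ≠ 0 := by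
  unfold ipDenPoly
  obtain rfl | hr := eq_or_ne r 0
  · refine toRF_ne_zero_of_eval (fun n => if n = 0 then 1 else 0) ?_
    simp [hk, hq]
  · obtain rfl := Fin.eq_one_of_ne_zero r hr
    refine toRF_ne_zero_of_eval (fun _ => 0) ?_
    simp

/-- **The weights as ratios of polynomials**: `weight · den = num` in the rapidity field (top level
`k ≠ 0`). [cite: IkhlefPonsaing2012, Def. 3.1, 3.3] -/
theorem ipRowWeight_mul_den {q : K₀} (hq : q ≠ 0) (r : Fin 2) {e : Sym2 (Site 2)}
    (hk : (edgeTopLevel e).toNat ≠ 0) :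
    ipRowWeight (genC K₀ q) (genW K₀) (genZ K₀) r e * toRF K₀ (ipDenPoly q r e) = toRF K₀ (ipNumPoly q r e) := by
  have hcq : genC K₀ q ≠ 0 := toRF_ne_zero_of_eval (fun _ => 1) (by simp [hq])
  have hw : genW K₀ ≠ 0 := genW_ne_zero
  have hz : genZ K₀ (edgeTopLevel e).toNat ≠ 0 := genZ_ne_zero _
  have hC : toRF K₀ (C q) = genC K₀ q := rfl
  have hX0 : toRF K₀ (X 0) = genW K₀ := rfl
  have hXk : toRF K₀ (X (edgeTopLevel e).toNat) = genZ K₀ (edgeTopLevel e).toNat := rfl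
  -- the two bracket denominators
  have hb0 : qbr (genC K₀ q / (genZ K₀ (edgeTopLevel e).toNat / genW K₀)) ≠ 0 := by
    rw [div_div_eq_mul_div]; exact qbr_genW_div_genZ_ne_zero hq hk
  have hb1 : qbr (genC K₀ q / (genW K₀ * genZ K₀ (edgeTopLevel e).toNat)⁻¹) ≠ 0 := by
    rw [div_inv_eq_mul, ← mul_assoc]; exact qbr_genW_mul_genZ_ne_zero hq _
  unfold ipRowWeight ipNumPoly ipDenPoly ipWtA ipWtB
  obtain rfl | hr := eq_or_ne r 0
  · simp only [if_true]
    split_ifs <;> simp only [map_sub, map_mul, map_pow, hC, hX0, hXk] <;>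
      rw [div_mul_eq_mul_div, div_eq_iff hb0] <;> unfold qbr <;> field_simp
  · obtain rfl := Fin.eq_one_of_ne_zero r hr
    simp only [show (1 : Fin 2) ≠ 0 from by decide, if_false]
    split_ifs <;> simp only [map_sub, map_mul, map_pow, map_one, hC, hX0, hXk] <;>
      rw [div_mul_eq_mul_div, div_eq_iff hb1] <;> unfold qbr <;> field_simp

/-- The weight as a ratio. [folklore] -/
theorem ipRowWeight_eq_div {q : K₀} (hq : q ≠ 0) (r : Fin 2) {e : Sym2 (Site 2)} (hk : (edgeTopLevel e).toNat ≠ 0) :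
    ipRowWeight (genC K₀ q) (genW K₀) (genZ K₀) r e = toRF K₀ (ipNumPoly q r e) / toRF K₀ (ipDenPoly q r e) := by
  rw [eq_div_iff (toRF_ipDenPoly_ne_zero hq r hk), ipRowWeight_mul_den hq r hk]

/-- The complementary weight: `(1 - weight) · den = den - num`. [folklore] -/
theorem one_sub_ipRowWeight_mul_den {q : K₀} (hq : q ≠ 0) (r : Fin 2) {e : Sym2 (Site 2)}
    (hk : (edgeTopLevel e).toNat ≠ 0) :
    (1 - ipRowWeight (genC K₀ q) (genW K₀) (genZ K₀) r e) * toRF K₀ (ipDenPoly q r e) =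
      toRF K₀ (ipDenPoly q r e - ipNumPoly q r e) := by
  rw [sub_mul, one_mul, ipRowWeight_mul_den hq r hk, map_sub]

/-- The evaluation point `(w₀, 1, 1, …)`. [folklore] -/
def ipEvalPt (w₀ : K₀) : ℕ → K₀ := fun n => if n = 0 then w₀ else 1

/-- **At the percolation point all numerators evaluate to `-1`** (`q² + q + 1 = 0`, `w₀² = -q`).
[cite: IkhlefPonsaing2012, §3.4] -/
theorem eval_ipNumPoly {q w₀ : K₀} (hq : q ^ 2 + q + 1 = 0) (hw : w₀ ^ 2 = -q) (r : Fin 2) {e : Sym2 (Site 2)}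
    (hk : (edgeTopLevel e).toNat ≠ 0) : eval (ipEvalPt w₀) (ipNumPoly q r e) = -1 := by
  unfold ipNumPoly ipEvalPt
  obtain rfl | hr := eq_or_ne r 0
  · simp only [if_true]
    split_ifs <;> simp [hk, hw] <;> linear_combination hq
  · obtain rfl := Fin.eq_one_of_ne_zero r hr
    simp only [show (1 : Fin 2) ≠ 0 from by decide, if_false]
    split_ifs <;> simp [hk, hw] <;> linear_combination hq

/-- **… and all denominators to `-2`.** [cite: IkhlefPonsaing2012, §3.4] -/
theorem eval_ipDenPoly {q w₀ : K₀} (hq : q ^ 2 + q + 1 = 0) (hw : w₀ ^ 2 = -q) (r : Fin 2) {e : Sym2 (Site 2)}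
    (hk : (edgeTopLevel e).toNat ≠ 0) : eval (ipEvalPt w₀) (ipDenPoly q r e) = -2 := by
  have hq3 : q ^ 3 = 1 := by linear_combination (q - 1) * hq
  unfold ipDenPoly ipEvalPt
  obtain rfl | hr := eq_or_ne r 0
  · simp [hk, hw]; linear_combination -hq3
  · obtain rfl := Fin.eq_one_of_ne_zero r hr
    simp [hk, hw]; linear_combination -hq3

end PolyWeights

/-! ### Generic simplicity of the eigenvalue `1` of `t(w; z⃗)` -/

section Simplicity

open _root_.Matrix MvPolynomial Literature.Probability.LatticeModels.TemperleyLieb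

variable {K₀ : Type*} [Field K₀]

/-- The generic transfer matrix `t(w; z⃗)` as a matrix over the rapidity field (`(Q, Q')` entry =
weight of `Q → Q'`). [cite: IkhlefPonsaing2012, Def. 3.3] -/
noncomputable def ipTMat (m : ℕ) (q : K₀) : Matrix (ColPattern m) (ColPattern m) (RapidityField K₀) :=
  Matrix.of fun Q Q' => ipTransferMatrixW m (genC K₀ q) (genW K₀) (genZ K₀) Q Q'

/-- The percolation-point transfer matrix (all weights `1/2`). [cite: IkhlefPonsaing2012, §3.4] -/
noncomputable def ipTMat0 (K₀ : Type*) [Field K₀] (m : ℕ) : Matrix (ColPattern m) (ColPattern m) K₀ :=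
  Matrix.of fun Q Q' => ipTwoLayerW m (fun _ => (1 / 2 : K₀)) (fun _ => (1 / 2 : K₀)) Q Q'

/-- The common denominator `Δ = ∏_{layer 0} den₀ · ∏_{layer 1} den₁`. [folklore] -/
noncomputable def ipDeltaPoly (m : ℕ) (q : K₀) : MvPolynomial ℕ K₀ :=
  (∏ e ∈ latticeLayer m 0, ipDenPoly q 0 e) * ∏ e ∈ latticeLayer m 1, ipDenPoly q 1 e

/-- The polynomial matrix `Δ · (t - 1)` (denominators cleared). [folklore] -/
noncomputable def ipNMat (m : ℕ) (q : K₀) : Matrix (ColPattern m) (ColPattern m) (MvPolynomial ℕ K₀) :=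
  Matrix.of (fun Q Q' => ipTwoLayerWR m (ipNumPoly q 0) (fun e => ipDenPoly q 0 e - ipNumPoly q 0 e)
      (ipNumPoly q 1) (fun e => ipDenPoly q 1 e - ipNumPoly q 1 e) Q Q') -
    ipDeltaPoly m q • (1 : Matrix (ColPattern m) (ColPattern m) (MvPolynomial ℕ K₀))

/-- Layer edges have nonzero top level. [folklore] -/
theorem level_ne_zero_of_mem {c : ℤ} (hc : c = 0 ∨ c = 1) {e : Sym2 (Site 2)} (he : e ∈ latticeLayer m c) :
    (edgeTopLevel e).toNat ≠ 0 :=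
  Nat.one_le_iff_ne_zero.1 (one_le_edgeTopLevel_of_mem hc he)

/-- **Clearing denominators in the rapidity field**: `toRF (N) = Δ · (t - 1)`. [folklore] -/
theorem mapMatrix_toRF_ipNMat {q : K₀} (hq : q ≠ 0) :
    (toRF K₀).mapMatrix (ipNMat m q) = toRF K₀ (ipDeltaPoly m q) • (ipTMat m q - 1) := by
  refine Matrix.ext fun Q Q' => ?_
  rw [RingHom.mapMatrix_apply, Matrix.map_apply]
  simp only [ipNMat, ipTMat, Matrix.sub_apply, Matrix.smul_apply, Matrix.of_apply, Matrix.one_apply,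
    smul_eq_mul, map_sub, map_mul, mul_sub]
  congr 1
  · -- the kernel entry
    rw [map_ipTwoLayerWR]
    set p₀ : Sym2 (Site 2) → RapidityField K₀ := ipRowWeight (genC K₀ q) (genW K₀) (genZ K₀) 0
    set p₁ : Sym2 (Site 2) → RapidityField K₀ := ipRowWeight (genC K₀ q) (genW K₀) (genZ K₀) 1
    have h0 : ∀ e ∈ latticeLayer m 0,
        ((toRF K₀) ∘ ipNumPoly q 0) e = toRF K₀ (ipDenPoly q 0 e) * p₀ e ∧
        ((toRF K₀) ∘ fun e => ipDenPoly q 0 e - ipNumPoly q 0 e) e = toRF K₀ (ipDenPoly q 0 e) * (1 - p₀ e) := by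
      intro e he
      have hk := level_ne_zero_of_mem (Or.inl rfl) he
      exact ⟨by rw [Function.comp_apply, mul_comm, ipRowWeight_mul_den hq 0 hk],
        by rw [Function.comp_apply, mul_comm, one_sub_ipRowWeight_mul_den hq 0 hk]⟩
    have h1 : ∀ e ∈ latticeLayer m 1,
        ((toRF K₀) ∘ ipNumPoly q 1) e = toRF K₀ (ipDenPoly q 1 e) * p₁ e ∧
        ((toRF K₀) ∘ fun e => ipDenPoly q 1 e - ipNumPoly q 1 e) e = toRF K₀ (ipDenPoly q 1 e) * (1 - p₁ e) := by
      intro e he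
      have hk := level_ne_zero_of_mem (Or.inr rfl) he
      exact ⟨by rw [Function.comp_apply, mul_comm, ipRowWeight_mul_den hq 1 hk],
        by rw [Function.comp_apply, mul_comm, one_sub_ipRowWeight_mul_den hq 1 hk]⟩
    rw [ipTwoLayerWR_congr h0 h1, ipTwoLayerWR_mul, ← ipTwoLayerW_eq_ipTwoLayerWR, ← ipTransferMatrixW_eq,
      ipDeltaPoly, map_mul, map_prod, map_prod]
  · split_ifs <;> simp

/-- **Evaluation at the percolation point**: `N(w₀, 1⃗) = Δ(w₀, 1⃗) · (t(½) - 1)`.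
[cite: IkhlefPonsaing2012, §3.4] -/
theorem mapMatrix_eval_ipNMat {q w₀ : K₀} (hq : q ^ 2 + q + 1 = 0) (hw : w₀ ^ 2 = -q) (h2 : (2 : K₀) ≠ 0) :
    (eval (ipEvalPt w₀)).mapMatrix (ipNMat m q) = eval (ipEvalPt w₀) (ipDeltaPoly m q) • (ipTMat0 K₀ m - 1) := by
  refine Matrix.ext fun Q Q' => ?_
  rw [RingHom.mapMatrix_apply, Matrix.map_apply]
  simp only [ipNMat, ipTMat0, Matrix.sub_apply, Matrix.smul_apply, Matrix.of_apply, Matrix.one_apply,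
    smul_eq_mul, map_sub, map_mul, mul_sub]
  congr 1
  · rw [map_ipTwoLayerWR]
    set u₀ : Sym2 (Site 2) → K₀ := fun e => eval (ipEvalPt w₀) (ipDenPoly q 0 e) with hu₀
    set u₁ : Sym2 (Site 2) → K₀ := fun e => eval (ipEvalPt w₀) (ipDenPoly q 1 e) with hu₁
    have hval : ∀ (r : Fin 2) (e : Sym2 (Site 2)), (edgeTopLevel e).toNat ≠ 0 →
        ((eval (ipEvalPt w₀)) ∘ ipNumPoly q r) e = eval (ipEvalPt w₀) (ipDenPoly q r e) * (1 / 2) ∧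
        ((eval (ipEvalPt w₀)) ∘ fun e => ipDenPoly q r e - ipNumPoly q r e) e =
          eval (ipEvalPt w₀) (ipDenPoly q r e) * (1 / 2) := by
      intro r e hk
      have hhalf : eval (ipEvalPt w₀) (ipDenPoly q r e) * (1 / 2) = -1 := by
        rw [eval_ipDenPoly hq hw r hk, mul_one_div, neg_div, div_self h2]
      rw [hhalf]
      simp only [Function.comp_apply, map_sub, eval_ipNumPoly hq hw r hk, eval_ipDenPoly hq hw r hk]
      norm_num
    have h0 : ∀ e ∈ latticeLayer m 0,
        ((eval (ipEvalPt w₀)) ∘ ipNumPoly q 0) e = u₀ e * (1 / 2) ∧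
        ((eval (ipEvalPt w₀)) ∘ fun e => ipDenPoly q 0 e - ipNumPoly q 0 e) e = u₀ e * (1 / 2) :=
      fun e he => hval 0 e (level_ne_zero_of_mem (Or.inl rfl) he)
    have h1 : ∀ e ∈ latticeLayer m 1,
        ((eval (ipEvalPt w₀)) ∘ ipNumPoly q 1) e = u₁ e * (1 / 2) ∧
        ((eval (ipEvalPt w₀)) ∘ fun e => ipDenPoly q 1 e - ipNumPoly q 1 e) e = u₁ e * (1 / 2) :=
      fun e he => hval 1 e (level_ne_zero_of_mem (Or.inr rfl) he)
    have e1 := ipTwoLayerWR_congr (m := m) h0 h1 Q Q'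
    have e2 := ipTwoLayerWR_mul (m := m) u₀ (fun _ => (1 / 2 : K₀)) (fun _ => 1 / 2) u₁ (fun _ => 1 / 2)
      (fun _ => 1 / 2) Q Q'
    have e3 : ipTwoLayerWR m (fun _ => (1 / 2 : K₀)) (fun _ => 1 / 2) (fun _ => 1 / 2) (fun _ => 1 / 2) Q Q' =
        ipTwoLayerW m (fun _ => (1 / 2 : K₀)) (fun _ => 1 / 2) Q Q' := by
      have hh : (1 : K₀) - 1 / 2 = 1 / 2 := by
        rw [sub_eq_iff_eq_add, ← two_mul, mul_one_div, div_self h2]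
      rw [ipTwoLayerW_eq_ipTwoLayerWR]
      exact ipTwoLayerWR_congr (fun e _ => ⟨rfl, hh.symm⟩) (fun e _ => ⟨rfl, hh.symm⟩) Q Q'
    have e4 : eval (ipEvalPt w₀) (ipDeltaPoly m q) = (∏ e ∈ latticeLayer m 0, u₀ e) * ∏ e ∈ latticeLayer m 1, u₁ e := by
      rw [ipDeltaPoly, map_mul, map_prod, map_prod]
    rw [e1, e2, e3, e4]
  · split_ifs <;> simp

/-- `Δ` does not vanish at the percolation point (characteristic `≠ 2`). [folklore] -/
theorem eval_ipDeltaPoly_ne_zero {q w₀ : K₀} (hq : q ^ 2 + q + 1 = 0) (hw : w₀ ^ 2 = -q) (h2 : (2 : K₀) ≠ 0) :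
    eval (ipEvalPt w₀) (ipDeltaPoly m q) ≠ 0 := by
  rw [ipDeltaPoly, map_mul, map_prod, map_prod]
  refine mul_ne_zero (Finset.prod_ne_zero_iff.2 fun e he => ?_) (Finset.prod_ne_zero_iff.2 fun e he => ?_)
  · rw [eval_ipDenPoly hq hw 0 (level_ne_zero_of_mem (Or.inl rfl) he)]
    exact neg_ne_zero.2 h2
  · rw [eval_ipDenPoly hq hw 1 (level_ne_zero_of_mem (Or.inr rfl) he)]
    exact neg_ne_zero.2 h2

/-- `Δ ≠ 0` in the rapidity field. [folklore] -/
theorem toRF_ipDeltaPoly_ne_zero {q : K₀} (hq : q ≠ 0) : toRF K₀ (ipDeltaPoly m q) ≠ 0 := by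
  rw [ipDeltaPoly, map_mul, map_prod, map_prod]
  refine mul_ne_zero (Finset.prod_ne_zero_iff.2 fun e he => ?_) (Finset.prod_ne_zero_iff.2 fun e he => ?_)
  · exact toRF_ipDenPoly_ne_zero hq 0 (level_ne_zero_of_mem (Or.inl rfl) he)
  · exact toRF_ipDenPoly_ne_zero hq 1 (level_ne_zero_of_mem (Or.inr rfl) he)

/-- **Rank semicontinuity through adjugates**: if the adjugate of `t(½) - 1` is nonzero at the
percolation point, the adjugate of the generic `t(w; z⃗) - 1` is nonzero. [folklore] -/
theorem adjugate_ipTMat_sub_one_ne_zero {q w₀ : K₀} (hq : q ^ 2 + q + 1 = 0) (hw : w₀ ^ 2 = -q)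
    (h2 : (2 : K₀) ≠ 0) (h0 : adjugate (ipTMat0 K₀ m - 1) ≠ 0) : adjugate (ipTMat m q - 1) ≠ 0 := by
  have hq0 : q ≠ 0 := ne_zero_of_quad hq
  intro h
  -- the adjugate of the polynomial matrix vanishes
  have hN : adjugate (ipNMat m q) = 0 := by
    have h1 : (toRF K₀).mapMatrix (adjugate (ipNMat m q)) = 0 := by
      rw [RingHom.map_adjugate, mapMatrix_toRF_ipNMat hq0, adjugate_smul, h, smul_zero]
    refine Matrix.ext fun Q Q' => ?_
    have := congrArg (fun M : Matrix _ _ (RapidityField K₀) => M Q Q') h1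
    simp only [RingHom.mapMatrix_apply, Matrix.map_apply, Matrix.zero_apply] at this
    rw [Matrix.zero_apply]
    exact toRF_injective (by rw [this, map_zero])
  -- hence so does its evaluation
  have h3 : adjugate (eval (ipEvalPt w₀) (ipDeltaPoly m q) • (ipTMat0 K₀ m - 1)) = 0 := by
    rw [← mapMatrix_eval_ipNMat hq hw h2, ← RingHom.map_adjugate, hN, map_zero]
  rw [adjugate_smul, smul_eq_zero] at h3
  rcases h3 with h3 | h3
  · exact pow_ne_zero _ (eval_ipDeltaPoly_ne_zero hq hw h2) h3
  · exact h0 h3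

/-- Row sums of `t(w; z⃗)` are `1`. [folklore] -/
theorem sum_ipTMat (q : K₀) (Q : ColPattern m) : ∑ Q', ipTMat m q Q Q' = 1 := by
  simp only [ipTMat, of_apply, ipTransferMatrixW_eq]
  exact sum_ipTwoLayerW _ _ Q

/-- Hence `t - 1` is singular. [folklore] -/
theorem det_ipTMat_sub_one (q : K₀) : (ipTMat m q - 1).det = 0 := by
  rw [← exists_mulVec_eq_zero_iff]
  refine ⟨fun _ => 1, ?_, ?_⟩
  · intro h
    have := congrFun h ((fun _ _ => false), fun _ => false)
    simp at this
  · funext Q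
    rw [sub_mulVec, one_mulVec, Pi.sub_apply, Pi.zero_apply, sub_eq_zero, mulVec, dotProduct]
    simp only [mul_one]
    exact sum_ipTMat q Q

end Simplicity

/-! ### The percolation point over `ℂ` and the conclusion -/

section ComplexPoint

open _root_.Matrix Literature.Probability.LatticeModels.TemperleyLieb

/-- Entries of the generic transfer matrix. [folklore] -/
theorem ipTMat_apply {K₀ : Type*} [Field K₀] (q : K₀) (Q Q' : ColPattern m) :
    ipTMat m q Q Q' = ipTransferMatrixW m (genC K₀ q) (genW K₀) (genZ K₀) Q Q' := rfl

/-- The entries of `t(½)` over `ℂ` are the real ones. [folklore] -/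
theorem ipTMat0_complex_apply (Q Q' : ColPattern m) :
    ipTMat0 ℂ m Q Q' = ((ipTwoLayerW m (fun _ => (1 / 2 : ℝ)) (fun _ => (1 / 2 : ℝ)) Q Q' : ℝ) : ℂ) := by
  rw [ipTMat0, of_apply, ← Complex.ofRealHom_eq_coe, map_ipTwoLayerW]
  have hf : (Complex.ofRealHom ∘ fun _ : Sym2 (Site 2) => (1 / 2 : ℝ)) = fun _ => (1 / 2 : ℂ) := by
    funext e; simp
  rw [hf]

/-- **Left fixed vectors of `t(½)` over `ℂ` form the line of `π̄`** (real and imaginary parts are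
real fixed vectors). [cite: IkhlefPonsaing2012, §3.4] -/
theorem ipTMat0_complex_vecMul_line (x : ColPattern m → ℂ) (hx : x ᵥ* (ipTMat0 ℂ m - 1) = 0) :
    ∃ a : ℂ, x = a • fun Q => (ipStationaryL m Q : ℂ) := by
  have hfix : ∀ Q', ∑ Q, x Q * ipTMat0 ℂ m Q Q' = x Q' := by
    intro Q'
    have := congrFun hx Q'
    rw [vecMul_sub, vecMul_one, Pi.sub_apply, Pi.zero_apply, sub_eq_zero, vecMul, dotProduct] at this
    exact this
  set t : ColPattern m → ColPattern m → ℝ := ipTwoLayerW m (fun _ => (1 / 2 : ℝ)) (fun _ => (1 / 2 : ℝ)) with ht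
  have hre : ∀ Q', ∑ Q, (x Q).re * t Q Q' = (x Q').re := by
    intro Q'
    have := congrArg Complex.re (hfix Q')
    rw [Complex.re_sum] at this
    simpa only [ipTMat0_complex_apply, Complex.re_mul_ofReal] using this
  have him : ∀ Q', ∑ Q, (x Q).im * t Q Q' = (x Q').im := by
    intro Q'
    have := congrArg Complex.im (hfix Q')
    rw [Complex.im_sum] at this
    simpa only [ipTMat0_complex_apply, Complex.im_mul_ofReal] using this
  have hxr := eq_smul_ipStationaryL_of_ipTwoLayerW_half (fun Q => (x Q).re) hre
  have hxi := eq_smul_ipStationaryL_of_ipTwoLayerW_half (fun Q => (x Q).im) him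
  refine ⟨((∑ Q, (x Q).re : ℝ) : ℂ) + ((∑ Q, (x Q).im : ℝ) : ℂ) * Complex.I, funext fun Q => ?_⟩
  have h1 : (x Q).re = (∑ Q, (x Q).re) * ipStationaryL m Q := by
    have := congrFun hxr Q; simpa using this
  have h2 : (x Q).im = (∑ Q, (x Q).im) * ipStationaryL m Q := by
    have := congrFun hxi Q; simpa using this
  apply Complex.ext
  · rw [h1]; simp [Complex.mul_re]
  · rw [h2]; simp [Complex.mul_im]

/-- **The adjugate of `t(½) - 1` is nonzero** (the eigenvalue `1` is simple at the percolation
point). [cite: IkhlefPonsaing2012, §3.4] -/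
theorem adjugate_ipTMat0_complex_sub_one_ne_zero : adjugate (ipTMat0 ℂ m - 1) ≠ 0 :=
  adjugate_ne_zero_of_vecMul_line _ (fun Q => (ipStationaryL m Q : ℂ)) (ipTMat0_complex_vecMul_line)
    ((fun _ _ => false), fun _ => false)

/-- **The adjugate of the generic `t(w; z⃗) - 1` is nonzero** (`q` a primitive cube root of unity
in `ℂ`). [cite: IkhlefPonsaing2012, §3.4] -/
theorem adjugate_ipTMat_complex_sub_one_ne_zero {q : ℂ} (hq : q ^ 2 + q + 1 = 0) :
    adjugate (ipTMat m q - 1) ≠ 0 := by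
  obtain ⟨w₀, hw⟩ := IsAlgClosed.exists_pow_nat_eq (-q) (n := 2) two_pos
  exact adjugate_ipTMat_sub_one_ne_zero hq hw two_ne_zero adjugate_ipTMat0_complex_sub_one_ne_zero

/-- **Generic simplicity of the ground state of IP12's transfer matrix** ("Since the ground state is
unique …", §3.4, made precise): over the field of rational functions in `w, z_1, z_2, …` (with `q`
a primitive cube root of unity), any two vectors fixed by `t(w; z⃗)` —
`ψ(Q') = Σ_Q t(w; z⃗)(Q → Q') ψ(Q)` — are proportional. [cite: IkhlefPonsaing2012, §3.4] -/
theorem ipTransferMatrixW_fixed_proportional {q : ℂ} (hq : q ^ 2 + q + 1 = 0)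
    {ψ ψ' : ColPattern m → RapidityField ℂ}
    (hψ : ∀ Q', ∑ Q, ipTransferMatrixW m (genC ℂ q) (genW ℂ) (genZ ℂ) Q Q' * ψ Q = ψ Q')
    (hψ' : ∀ Q', ∑ Q, ipTransferMatrixW m (genC ℂ q) (genW ℂ) (genZ ℂ) Q Q' * ψ' Q = ψ' Q') (k : ColPattern m) :
    ψ' k • ψ = ψ k • ψ' := by
  have hker : ∀ φ : ColPattern m → RapidityField ℂ,
      (∀ Q', ∑ Q, ipTransferMatrixW m (genC ℂ q) (genW ℂ) (genZ ℂ) Q Q' * φ Q = φ Q') → φ ᵥ* (ipTMat m q - 1) = 0 := by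
    intro φ hφ
    funext Q'
    rw [vecMul_sub, vecMul_one, Pi.sub_apply, Pi.zero_apply, sub_eq_zero, vecMul, dotProduct]
    simp only [ipTMat, of_apply]
    rw [← hφ Q']
    exact Finset.sum_congr rfl fun Q _ => mul_comm _ _
  exact vecMul_proportional_of_adjugate_ne_zero _ (adjugate_ipTMat_complex_sub_one_ne_zero hq) (hker ψ hψ)
    (hker ψ' hψ') k

/-- **… and a nonzero fixed vector exists** (a row of the adjugate; it can be taken with polynomial
components after clearing denominators). [cite: IkhlefPonsaing2012, §3.4] -/
theorem exists_ipTransferMatrixW_fixed_ne_zero {q : ℂ} (hq : q ^ 2 + q + 1 = 0) :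
    ∃ ψ : ColPattern m → RapidityField ℂ, ψ ≠ 0 ∧
      ∀ Q', ∑ Q, ipTransferMatrixW m (genC ℂ q) (genW ℂ) (genZ ℂ) Q Q' * ψ Q = ψ Q' := by
  have hA := adjugate_ipTMat_complex_sub_one_ne_zero (m := m) hq
  obtain ⟨i, j, hij⟩ : ∃ i j, adjugate (ipTMat m q - 1) i j ≠ 0 := by
    by_contra h
    simp only [not_exists, not_not] at h
    exact hA (Matrix.ext fun i j => h i j)
  refine ⟨fun j' => adjugate (ipTMat m q - 1) i j', fun h0 => hij (by simpa using congrFun h0 j), fun Q' => ?_⟩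
  have := congrFun (adjugate_row_vecMul (ipTMat m q - 1) (det_ipTMat_sub_one q) i) Q'
  rw [vecMul_sub, vecMul_one, Pi.sub_apply, Pi.zero_apply, sub_eq_zero, vecMul, dotProduct] at this
  simp only [ipTMat_apply] at this
  simp only
  rw [← this]
  exact Finset.sum_congr rfl fun Q _ => mul_comm _ _

end ComplexPoint

/-! ### A polynomial representative of the generic ground state -/

section PolynomialRepresentative

/-- **The generic ground state can be taken with polynomial components**: clearing the
denominators of the fixed vector of `exists_ipTransferMatrixW_fixed_ne_zero`.
[cite: IkhlefPonsaing2012, §3.4] -/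
theorem exists_ipTransferMatrixW_fixed_polynomial {q : ℂ} (hq : q ^ 2 + q + 1 = 0) :
    ∃ P : ColPattern m → MvPolynomial ℕ ℂ, P ≠ 0 ∧
      ∀ Q', ∑ Q, ipTransferMatrixW m (genC ℂ q) (genW ℂ) (genZ ℂ) Q Q' * toRF ℂ (P Q) = toRF ℂ (P Q') := by
  obtain ⟨ψ, hψ0, hψ⟩ := exists_ipTransferMatrixW_fixed_ne_zero (m := m) hq
  -- write every component as a fraction
  have hfrac : ∀ Q, ∃ ab : MvPolynomial ℕ ℂ × MvPolynomial ℕ ℂ, ab.2 ≠ 0 ∧ ψ Q = toRF ℂ ab.1 / toRF ℂ ab.2 := by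
    intro Q
    obtain ⟨a, b, hb, hab⟩ := IsFractionRing.div_surjective (A := MvPolynomial ℕ ℂ) (ψ Q)
    exact ⟨(a, b), nonZeroDivisors.ne_zero hb, hab.symm⟩
  choose ab hab using hfrac
  set D : MvPolynomial ℕ ℂ := ∏ Q, (ab Q).2 with hD
  have hD0 : D ≠ 0 := Finset.prod_ne_zero_iff.2 fun Q _ => (hab Q).1
  -- the polynomial vector `P Q := a_Q · ∏_{Q' ≠ Q} b_{Q'}`
  refine ⟨fun Q => (ab Q).1 * ∏ Q' ∈ Finset.univ.erase Q, (ab Q').2, ?_, ?_⟩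
  · -- nonzero: `toRF (P Q) = D · ψ Q`
    intro hP
    apply hψ0
    funext Q
    have hPQ := congrFun hP Q
    simp only [Pi.zero_apply, mul_eq_zero, Finset.prod_eq_zero_iff, Finset.mem_erase] at hPQ
    rcases hPQ with h | ⟨Q', ⟨-, -⟩, hQ'⟩
    · rw [Pi.zero_apply, (hab Q).2, h, map_zero, zero_div]
    · exact absurd hQ' (hab Q').1
  · have hkey : ∀ Q, toRF ℂ ((ab Q).1 * ∏ Q' ∈ Finset.univ.erase Q, (ab Q').2) = toRF ℂ D * ψ Q := by
      intro Q
      have hb : toRF ℂ (ab Q).2 ≠ 0 := toRF_ne_zero_of_ne_zero' (hab Q).1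
      rw [(hab Q).2, map_mul, map_prod, hD, map_prod, ← Finset.mul_prod_erase _ _ (Finset.mem_univ Q)]
      field_simp
    intro Q'
    simp only [hkey]
    rw [← hψ Q', Finset.mul_sum]
    refine Finset.sum_congr rfl fun Q _ => ?_
    ring
where
  /-- helper: injectivity of `toRF` on nonzero polynomials -/
  toRF_ne_zero_of_ne_zero' {P : MvPolynomial ℕ ℂ} (h : P ≠ 0) : toRF ℂ P ≠ 0 := fun h0 =>
    h (toRF_injective (by rw [h0, map_zero]))

end PolynomialRepresentative

end Literature.Probability.Percolation
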